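import Summits.RiemannHypothesis.RiemannHypothesis.Theorems.OddSectorOddOneSignedWindowsFormDomainDilation
import Literature.NumberTheory.LFunctions.WeilOddThetaVector
import Literature.NumberTheory.LFunctions.DeBruijnPhiSecondDeriv
import Summits.RiemannHypothesis.RiemannHypothesis.Theorems.WeilWindowFlowWindowLipschitzStubBarrierEnergy
import HarnessLib

/-!
# The odd theta vector `H_a = −Φ′𝟙_{[-a,a]}` has finite energy
# (helper for crux `OddSector.OddOneSignedWindows`, item stmt-RiemannHypothesis-17778; RH-free)

The odd theta vector `H_a = weilOddThetaVector a` (Literature, `WeilOddThetaVector.lean`) is the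
comparison function of the route `OddSector`: the Barta pairing of `OddBartaFloor` pairs the odd
ground state `u` of the crux with `H_a`, and the crux's lines read the sign of `u` against it
(theta envelope, overlap). `H_a` is NOT a test function (it jumps at `±a`), but it belongs to the
ODD FORM DOMAIN of the window: it is odd, bounded, lives on `[-a, a]`, and — the content of this file
— its archimedean energy density `ρ(t) D_t(H_a)` is integrable on `(0, ∞)`
(`integrableOn_archEnergy_weilOddThetaVector`), because `Φ′` is `C¹` (`hasDerivAt_weilThetaPhiDeriv`,
`continuous_deBruijnPhiDeriv₂`) hence Lipschitz on compacts, so that a jump function with a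
Lipschitz interior has increments `D_t(H_a) ≤ K·t` for `0 < t ≤ 1`
(`weilIncrement_weilOddThetaVector_le`: interior `≤ 2a L² t²`, the two jump layers `≤ 2 S² t`),
and `ρ(t) ≲ 1/(2t)` at `0⁺`, `ρ(t) ≲ e^{-t/2}` at infinity. Consequently the form-domain weak
Euler–Lagrange equation (`oddGroundState_eulerLagrange_formDomain`) applies to the direction
`w = H_a`: that is Barta's identity `B(u, H_a) = ε_od(a)⟨u, H_a⟩` in the tree's closed form.

References: 2001 programme, route `odd-sector-eigenfunction-sign`, results §§2–4 (Thm A: `H_a ∈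
D(A_a)`); E. Bombieri, Rend. Mat. Acc. Lincei (9) 11 (2000), §4.
-/

noncomputable section

set_option linter.dupNamespace false

open MeasureTheory Set Filter
open scoped Topology ENNReal

namespace Summit.RiemannHypothesis.RiemannHypothesis.Theorems.OddSector

open Literature.NumberTheory.LFunctions Literature.NumberTheory.LFunctions.ConnesVanSuijlekom
open Summit.RiemannHypothesis.RiemannHypothesis.Theorems.WeilGroundStateMarkovPart
open Summit.RiemannHypothesis.RiemannHypothesis.Theorems.WeilWindowFlowWindowLipschitz

/-! ### `Φ′` is `C¹`, hence Lipschitz on compacts -/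

/-- `Φ_RT″ = deBruijnPhiDeriv₂` is continuous (a combination of the continuous `E_{j,k}(2u)`).
[folklore] -/
theorem continuous_deBruijnPhiDeriv₂ : Continuous deBruijnPhiDeriv₂ := by
  unfold deBruijnPhiDeriv₂
  have h : ∀ j k : ℕ, Continuous fun u : ℝ ↦ expThetaMoment j k (2 * u) := fun j k ↦
    (continuous_expThetaMoment j k).comp (continuous_const.mul continuous_id)
  exact (((continuous_const.mul (h 2 2)).sub (continuous_const.mul (h 3 3))).sub
    (continuous_const.mul (h 1 1))).add (continuous_const.mul (h 4 4))

/-- **`Φ′` is differentiable**: `weilThetaPhiDeriv t = Φ_RT′(t/2)` has derivative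
`(1/2) Φ_RT″(t/2)`. [folklore] -/
theorem hasDerivAt_weilThetaPhiDeriv (t : ℝ) :
    HasDerivAt weilThetaPhiDeriv ((1 / 2) * deBruijnPhiDeriv₂ (t / 2)) t := by
  have h2 : HasDerivAt (fun x : ℝ ↦ x / 2) (1 / 2) t := by
    simpa using (hasDerivAt_id t).div_const 2
  have h := (hasDerivAt_deBruijnPhiDeriv (t / 2)).comp t h2
  have e : deBruijnPhiDeriv₂ (t / 2) * (1 / 2) = (1 / 2) * deBruijnPhiDeriv₂ (t / 2) := by ring
  rw [e] at h
  exact h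

/-- **`Φ′` is Lipschitz on every compact interval**: there is `L ≥ 0` with
`|Φ′(x) − Φ′(y)| ≤ L|x − y|` for `x, y ∈ [-R, R]` (mean value theorem; `Φ″` is continuous).
[folklore] -/
theorem exists_lipschitz_weilThetaPhiDeriv (R : ℝ) :
    ∃ L : ℝ, 0 ≤ L ∧ ∀ x ∈ Icc (-R) R, ∀ y ∈ Icc (-R) R,
      |weilThetaPhiDeriv y - weilThetaPhiDeriv x| ≤ L * |y - x| := by
  have hcont : Continuous fun t : ℝ ↦ (1 / 2) * deBruijnPhiDeriv₂ (t / 2) :=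
    continuous_const.mul (continuous_deBruijnPhiDeriv₂.comp (continuous_id.div_const 2))
  obtain ⟨C, hC⟩ := (isCompact_Icc (a := -R) (b := R)).exists_bound_of_continuousOn hcont.continuousOn
  refine ⟨max C 0, le_max_right _ _, fun x hx y hy ↦ ?_⟩
  have hderiv : ∀ z ∈ Icc (-R) R, ‖deriv weilThetaPhiDeriv z‖ ≤ max C 0 := fun z hz ↦ by
    rw [(hasDerivAt_weilThetaPhiDeriv z).deriv]
    exact (hC z hz).trans (le_max_left _ _)
  have h := Convex.norm_image_sub_le_of_norm_deriv_le (𝕜 := ℝ) (f := weilThetaPhiDeriv)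
    (fun z _ ↦ (hasDerivAt_weilThetaPhiDeriv z).differentiableAt) hderiv (convex_Icc (-R) R) hx hy
  simpa only [Real.norm_eq_abs] using h

/-! ### Increments of the odd theta vector -/

/-- The odd theta vector as a complex-valued window function. [folklore] -/
theorem weilOddThetaVector_complex_apply (a t : ℝ) :
    (fun x ↦ ((weilOddThetaVector a x : ℝ) : ℂ)) t = (weilOddThetaVector a t : ℂ) := rfl

/-- **Increments of the odd theta vector are `O(t)`**: for `a ≥ 0` there is `K` with
`D_t(H_a) ≤ K t` for all `0 < t ≤ 1` (interior Lipschitz part `2a L² t²`, jump layers at `±a` of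
total measure `2t` and height `≤ S = sup|H_a|`). [folklore] -/
theorem weilIncrement_weilOddThetaVector_le {a : ℝ} (ha : 0 ≤ a) :
    ∃ K : ℝ, 0 ≤ K ∧ ∀ t : ℝ, 0 < t → t ≤ 1 →
      weilIncrement (fun x ↦ ((weilOddThetaVector a x : ℝ) : ℂ)) t ≤ K * t := by
  obtain ⟨L, hL0, hL⟩ := exists_lipschitz_weilThetaPhiDeriv (a + 1)
  obtain ⟨S, hS0, hS⟩ := exists_abs_weilOddThetaVector_le a
  set H : ℝ → ℂ := fun x ↦ ((weilOddThetaVector a x : ℝ) : ℂ) with hH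
  have hHm : MemLp H 2 := (memLp_weilOddThetaVector a 2).ofReal
  refine ⟨2 * a * L ^ 2 + 2 * S ^ 2, by positivity, fun t ht ht1 ↦ ?_⟩
  -- the dominating step function
  set g : ℝ → ℝ := fun x ↦ (L * t) ^ 2 * (Icc (-a) a).indicator (fun _ ↦ (1 : ℝ)) x +
    S ^ 2 * ((Icc (-a - t) (-a)).indicator (fun _ ↦ (1 : ℝ)) x +
      (Icc (a - t) a).indicator (fun _ ↦ (1 : ℝ)) x) with hg
  have hind : ∀ (s : Set ℝ) (x : ℝ), 0 ≤ s.indicator (fun _ ↦ (1 : ℝ)) x := fun s x ↦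
    Set.indicator_nonneg (fun _ _ ↦ zero_le_one) _
  have hpt : ∀ x, ‖H (x + t) - H x‖ ^ 2 ≤ g x := by
    intro x
    by_cases hx : x ∈ Icc (-a) a
    · by_cases hxt : x + t ∈ Icc (-a) a
      · -- interior pair: Lipschitz
        have h1 : ‖H (x + t) - H x‖ ≤ L * t := by
          simp only [hH, weilOddThetaVector_of_mem hx, weilOddThetaVector_of_mem hxt,
            ← Complex.ofReal_sub, Complex.norm_real, Real.norm_eq_abs]
          have := hL x ⟨by linarith [hx.1], by linarith [hx.2]⟩ (x + t)
            ⟨by linarith [hxt.1], by linarith [hxt.2]⟩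
          rw [show x + t - x = t by ring, abs_of_pos ht] at this
          calc |(-weilThetaPhiDeriv (x + t)) - -weilThetaPhiDeriv x|
              = |weilThetaPhiDeriv (x + t) - weilThetaPhiDeriv x| := by
                rw [← abs_neg]; congr 1; ring
            _ ≤ L * t := this
        calc ‖H (x + t) - H x‖ ^ 2 ≤ (L * t) ^ 2 := pow_le_pow_left₀ (norm_nonneg _) h1 2
          _ = (L * t) ^ 2 * (Icc (-a) a).indicator (fun _ ↦ (1 : ℝ)) x := by
              rw [indicator_of_mem hx, mul_one]
          _ ≤ g x := le_add_of_nonneg_right (mul_nonneg (sq_nonneg _)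
              (add_nonneg (hind _ _) (hind _ _)))
      · -- right jump layer: `x ∈ (a - t, a]`
        have hxr : x ∈ Icc (a - t) a := by
          refine ⟨?_, hx.2⟩
          rw [mem_Icc, not_and_or, not_le, not_le] at hxt
          rcases hxt with h | h
          · linarith [hx.1]
          · linarith
        have h1 : ‖H (x + t) - H x‖ ≤ S := by
          simp only [hH, weilOddThetaVector_of_not_mem hxt, Complex.ofReal_zero, zero_sub, norm_neg,
            Complex.norm_real, Real.norm_eq_abs]
          exact hS x
        calc ‖H (x + t) - H x‖ ^ 2 ≤ S ^ 2 := pow_le_pow_left₀ (norm_nonneg _) h1 2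
          _ ≤ S ^ 2 * ((Icc (-a - t) (-a)).indicator (fun _ ↦ (1 : ℝ)) x +
              (Icc (a - t) a).indicator (fun _ ↦ (1 : ℝ)) x) := by
              rw [indicator_of_mem hxr]
              nlinarith [hind (Icc (-a - t) (-a)) x, sq_nonneg S]
          _ ≤ g x := le_add_of_nonneg_left (mul_nonneg (sq_nonneg _) (hind _ _))
    · by_cases hxt : x + t ∈ Icc (-a) a
      · -- left jump layer: `x ∈ [-a - t, -a)`
        have hxl : x ∈ Icc (-a - t) (-a) := by
          refine ⟨by linarith [hxt.1], ?_⟩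
          rw [mem_Icc, not_and_or, not_le, not_le] at hx
          rcases hx with h | h
          · linarith
          · linarith [hxt.2]
        have h1 : ‖H (x + t) - H x‖ ≤ S := by
          simp only [hH, weilOddThetaVector_of_not_mem hx, Complex.ofReal_zero, sub_zero,
            Complex.norm_real, Real.norm_eq_abs]
          exact hS (x + t)
        calc ‖H (x + t) - H x‖ ^ 2 ≤ S ^ 2 := pow_le_pow_left₀ (norm_nonneg _) h1 2
          _ ≤ S ^ 2 * ((Icc (-a - t) (-a)).indicator (fun _ ↦ (1 : ℝ)) x +
              (Icc (a - t) a).indicator (fun _ ↦ (1 : ℝ)) x) := by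
              rw [indicator_of_mem hxl]
              nlinarith [hind (Icc (a - t) a) x, sq_nonneg S]
          _ ≤ g x := le_add_of_nonneg_left (mul_nonneg (sq_nonneg _) (hind _ _))
      · simp only [hH, weilOddThetaVector_of_not_mem hx, weilOddThetaVector_of_not_mem hxt,
          Complex.ofReal_zero, sub_zero, norm_zero]
        rw [zero_pow two_ne_zero]
        exact add_nonneg (mul_nonneg (sq_nonneg _) (hind _ _))
          (mul_nonneg (sq_nonneg _) (add_nonneg (hind _ _) (hind _ _)))
  -- integrate
  have hconst : ∀ (c d : ℝ), c ≤ d → Integrable ((Icc c d).indicator fun _ : ℝ ↦ (1 : ℝ)) :=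
    fun c d _ ↦ (integrableOn_const (μ := volume) (s := Icc c d) (C := (1 : ℝ))
      (measure_Icc_lt_top).ne).integrable_indicator measurableSet_Icc
  have hIcc : ∀ (c d : ℝ), c ≤ d → ∫ x, (Icc c d).indicator (fun _ : ℝ ↦ (1 : ℝ)) x = d - c :=
    fun c d hcd ↦ by
      rw [integral_indicator_const _ measurableSet_Icc, Real.volume_real_Icc_of_le hcd, smul_eq_mul,
        mul_one]
  have i1 := hconst (-a) a (by linarith)
  have i2 := hconst (-a - t) (-a) (by linarith)
  have i3 := hconst (a - t) a (by linarith)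
  have iA : Integrable (fun x ↦ (L * t) ^ 2 * (Icc (-a) a).indicator (fun _ : ℝ ↦ (1 : ℝ)) x) :=
    i1.const_mul _
  have i23 : Integrable (fun x ↦ (Icc (-a - t) (-a)).indicator (fun _ : ℝ ↦ (1 : ℝ)) x +
      (Icc (a - t) a).indicator (fun _ : ℝ ↦ (1 : ℝ)) x) := i2.add i3
  have iB : Integrable (fun x ↦ S ^ 2 * ((Icc (-a - t) (-a)).indicator (fun _ : ℝ ↦ (1 : ℝ)) x +
      (Icc (a - t) a).indicator (fun _ : ℝ ↦ (1 : ℝ)) x)) := i23.const_mul _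
  have hgi : Integrable g := iA.add iB
  have hgint : ∫ x, g x = (L * t) ^ 2 * (2 * a) + S ^ 2 * (2 * t) := by
    show (∫ x, ((L * t) ^ 2 * (Icc (-a) a).indicator (fun _ : ℝ ↦ (1 : ℝ)) x +
      S ^ 2 * ((Icc (-a - t) (-a)).indicator (fun _ : ℝ ↦ (1 : ℝ)) x +
        (Icc (a - t) a).indicator (fun _ : ℝ ↦ (1 : ℝ)) x))) = _
    rw [integral_add iA iB, integral_const_mul, integral_const_mul, integral_add i2 i3,
      hIcc (-a) a (by linarith), hIcc (-a - t) (-a) (by linarith), hIcc (a - t) a (by linarith)]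
    ring
  calc weilIncrement H t = ∫ x, ‖H (x + t) - H x‖ ^ 2 := rfl
    _ ≤ ∫ x, g x := integral_mono (integrable_weilIncrement_integrand hHm t) hgi hpt
    _ = (L * t) ^ 2 * (2 * a) + S ^ 2 * (2 * t) := hgint
    _ ≤ (2 * a * L ^ 2 + 2 * S ^ 2) * t := by
        have ht2 : t * t ≤ t := by nlinarith
        have h1 : 2 * a * L ^ 2 * (t * t) ≤ 2 * a * L ^ 2 * t :=
          mul_le_mul_of_nonneg_left ht2 (by positivity)
        nlinarith [h1]

/-! ### The energy of the odd theta vector -/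

/-- **The odd theta vector has finite archimedean energy**: `t ↦ ρ(t) D_t(H_a)` is integrable on
`(0, ∞)` (`H_a` as a complex-valued window function). Near `0`: `D_t(H_a) ≤ K t` and
`ρ(t) ≤ e^{1/2}/(2t)` (`sinh t ≥ t`); at infinity: `D_t ≤ 4‖H_a‖₂²` and `ρ(t) ≤ e^{-t/2}/(1 − e^{-2})`.
So `H_a` lies in the odd form domain of the window `a` and the form-domain Euler–Lagrange equation
applies to it (registered sub-goal `integrableOn_archEnergy_weilOddThetaVector` of item
stmt-RiemannHypothesis-17778). [folklore] -/
theorem integrableOn_archEnergy_weilOddThetaVector :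
    ∀ a : ℝ, 0 < a → IntegrableOn (fun t ↦ weilArchDensity t *
      weilIncrement (fun x ↦ ((weilOddThetaVector a x : ℝ) : ℂ)) t) (Ioi 0) := by
  intro a ha
  set H : ℝ → ℂ := fun x ↦ ((weilOddThetaVector a x : ℝ) : ℂ) with hH
  have hHm : MemLp H 2 := (memLp_weilOddThetaVector a 2).ofReal
  have hHs : ∀ x, x ∉ Icc (-a) a → H x = 0 := fun x hx ↦ by
    simp only [hH, weilOddThetaVector_of_not_mem hx, Complex.ofReal_zero]
  have hHo : ∀ x, H (-x) = -H x := fun x ↦ by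
    simp only [hH, weilOddThetaVector_neg, Complex.ofReal_neg]
  obtain ⟨K, hK0, hK⟩ := weilIncrement_weilOddThetaVector_le ha.le
  set N : ℝ := ∫ x, ‖H x‖ ^ 2 with hN
  have hN0 : 0 ≤ N := integral_nonneg fun _ ↦ by positivity
  have hD : Continuous (weilIncrement H) := continuous_weilIncrement_of_memLp hHm hHs hHo
  have hmeas : AEStronglyMeasurable (fun t ↦ weilArchDensity t * weilIncrement H t)
      (volume.restrict (Ioi 0)) :=
    (measurable_weilArchDensity.mul hD.measurable).aestronglyMeasurable
  -- dominator: a constant on `(0, 1]` plus an exponential tail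
  set q : ℝ := 1 - Real.exp (-(4 * (1 / 2 : ℝ))) with hq
  have hq0 : 0 < q := by rw [hq, sub_pos, Real.exp_lt_one_iff]; norm_num
  set bound : ℝ → ℝ := fun t ↦ (Ioc (0 : ℝ) 1).indicator (fun _ ↦ Real.exp (1 / 2) * K / 2) t +
    4 * N * (Real.exp (-(t / 2)) / q) with hbound
  have hbi : IntegrableOn bound (Ioi 0) := by
    refine Integrable.add ?_ ?_
    · exact ((integrableOn_const (μ := volume) (s := Ioc (0 : ℝ) 1) (C := Real.exp (1 / 2) * K / 2)
        (measure_Ioc_lt_top).ne).integrable_indicator measurableSet_Ioc).integrableOn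
    · have he : IntegrableOn (fun t : ℝ ↦ Real.exp (-(t / 2))) (Ioi 0) := by
        have := exp_neg_integrableOn_Ioi 0 (by norm_num : (0 : ℝ) < 1 / 2)
        exact this.congr_fun (fun t _ ↦ by ring_nf) measurableSet_Ioi
      exact (he.div_const q).const_mul (4 * N)
  refine hbi.mono' hmeas ((ae_restrict_iff' measurableSet_Ioi).2 (Eventually.of_forall fun t ht ↦ ?_))
  have ht0 : (0 : ℝ) < t := ht
  have hρ0 : 0 < weilArchDensity t := weilArchDensity_pos ht0
  have hDt : 0 ≤ weilIncrement H t := weilIncrement_nonneg H t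
  rw [Real.norm_of_nonneg (mul_nonneg hρ0.le hDt)]
  have hb2 : 0 ≤ 4 * N * (Real.exp (-(t / 2)) / q) := by positivity
  have hb1 : 0 ≤ (Ioc (0 : ℝ) 1).indicator (fun _ ↦ Real.exp (1 / 2) * K / 2) t :=
    Set.indicator_nonneg (fun _ _ ↦ by positivity) _
  rcases le_or_gt t 1 with ht1 | ht1
  · -- `0 < t ≤ 1`: `ρ(t) D_t ≤ (e^{1/2}/(2t)) · K t`
    have hsinh : t ≤ Real.sinh t := Real.self_le_sinh_iff.2 ht0.le
    have hρ : weilArchDensity t ≤ Real.exp (1 / 2) / (2 * t) := by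
      unfold weilArchDensity
      have h1 : Real.exp (t / 2) ≤ Real.exp (1 / 2) := Real.exp_le_exp.2 (by linarith)
      calc Real.exp (t / 2) / (2 * Real.sinh t) ≤ Real.exp (1 / 2) / (2 * Real.sinh t) :=
            div_le_div_of_nonneg_right h1 (by positivity)
        _ ≤ Real.exp (1 / 2) / (2 * t) :=
            div_le_div_of_nonneg_left (by positivity) (by positivity) (by linarith)
    calc weilArchDensity t * weilIncrement H t ≤ (Real.exp (1 / 2) / (2 * t)) * (K * t) :=
          mul_le_mul hρ (hK t ht0 ht1) hDt (by positivity)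
      _ = Real.exp (1 / 2) * K / 2 := by field_simp
      _ = (Ioc (0 : ℝ) 1).indicator (fun _ ↦ Real.exp (1 / 2) * K / 2) t := by
          rw [indicator_of_mem (show t ∈ Ioc (0 : ℝ) 1 from ⟨ht0, ht1⟩)]
      _ ≤ bound t := le_add_of_nonneg_right hb2
  · -- `t > 1`: `D_t ≤ 4N`, `ρ(t) ≤ e^{-t/2}/q`
    have hρ : weilArchDensity t ≤ Real.exp (-(t / 2)) / q :=
      weilArchDensity_le_exp_neg (b := 1 / 2) (by norm_num) (by linarith)
    calc weilArchDensity t * weilIncrement H t ≤ (Real.exp (-(t / 2)) / q) * (4 * N) :=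
          mul_le_mul hρ (stub_barrierEnergy_weilIncrement_le_four hHm t) hDt (by positivity)
      _ = 4 * N * (Real.exp (-(t / 2)) / q) := by ring
      _ ≤ bound t := le_add_of_nonneg_left hb1

end Summit.RiemannHypothesis.RiemannHypothesis.Theorems.OddSector

end
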